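import Summits.AtomisticToContinuum.FouriersLaw.Theorems.JunctionLocalityNonBallisticOfWindow
import Summits.AtomisticToContinuum.FouriersLaw.Theorems.JunctionLocalityNonBallisticWindowOfLocalityAndDrude
import Summits.AtomisticToContinuum.FouriersLaw.Theses.CurrentTiltQuench
import Summits.AtomisticToContinuum.FouriersLaw.Theorems.JunctionLocalityNonBallisticStubAutocorrelationDomination
import Summits.AtomisticToContinuum.FouriersLaw.Theorems.JunctionLocalityNonBallisticStubInfiniteVolumeWitness
import Summits.AtomisticToContinuum.FouriersLaw.Theorems.JunctionLocalityNonBallisticStubWindowLimitOfPointwise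
import Summits.AtomisticToContinuum.FouriersLaw.Theorems.JunctionLocalityNonBallisticStubCesaroTwoOfCesaroOne
import Summits.AtomisticToContinuum.FouriersLaw.Theorems.EmbeddedDrudeMourreAbelThermodynamicLimitFixedTimeOffsetMatching
import Summits.AtomisticToContinuum.FouriersLaw.Theorems.JunctionLocalityNonBallisticStubBulkWindowDynamicalMatching
import Summits.AtomisticToContinuum.FouriersLaw.Theorems.JunctionLocalityNonBallisticStubBulkAnchorMatchingOfDynamicalMatching
import Summits.AtomisticToContinuum.FouriersLaw.Theorems.JunctionLocalityNonBallisticStubFixedTimeThermodynamicLimitOfBulkMatching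
import Summits.AtomisticToContinuum.FouriersLaw.Theorems.JunctionLocalityNonBallisticStubDrudeFromTruncationRegular
import Literature.MathematicalPhysics.KineticTheory.InfiniteChainDynamics
import Literature.MathematicalPhysics.KineticTheory.InfiniteChainInvariantStates
import Literature.MathematicalPhysics.KineticTheory.InfiniteChainSuperstableDynamics

/-!
# Line `drude-controls-conductance`, reshape R2 — checked skeleton for crux `NonBallistic`
(stmt-AtomisticToContinuum-9127; routes JunctionLocality (primary, rank 3) / PuiseuxTransferLedger (rank 3) /
BondHeatUncertainty (support) — one shared decl text; lead c3 = prover-line-stmt-AtomisticToContinuum-9127-c3-0, 2026-08-17)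

State inherited from R1/R1b (lead c2): the LEVER is landed — stubs 1–6 (`stub_autocorrelationContinuous` p121259,
`stub_timeIntegratedCurrentMean` p123125, `stub_equilibriumTimeIntegratedCurrentVariance` p121435,
`stub_timeIntegratedCurrentVarianceContinuity` p123085, `stub_totalHeatPathwiseIdentity` p121901, `stub_totalCurrentFTURTransfer` p121654)
are theorems of the tree, and so are the two compositions `nonBallistic_of_subballisticTransitWindow` ((K) ∧ W ⇒ crux, p123886) and
`subballisticTransitWindow_of_fixedTimeLocality_of_zeroDrudeWeight` (FixedTimeCurrentLocality ∧ ZeroDrudeWeightLiminf ⇒ W, p123204).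
R1's only open stub was W = `stub_subballisticTransitWindow` (crux-sized as ONE statement: it is zero Drude weight + fixed-time locality).

WHAT R2 CHANGES (lead's right, L4; composition idea unchanged = "FTUR(total current) × (K) isolates G_N² against Var_eq(Φ_t)/(N t²) at a
FIXED time t, and that per-site variance is small at some fixed time iff the INFINITE pinned chain has zero Drude weight"): W is cut along
the tree's infinite-chain library (Buttà–Marchioro dynamics `OscillatorChain.exists_bmDynamics`, DLR Gibbs states, uniqueness and
superstability of the shift-invariant DLR state `eq_of_isChainGibbsMeasure_of_isShiftInvariant_pinnedChain` /
`hasSuperstabilityEstimate_of_isShiftInvariant_pinnedChain`, fixed-time L² locality `InfiniteChainL2Locality.exists_summable_l2_locality`,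
Green–Kubo objects `InfiniteChainDynamics.currentCorrelation` / `HasAbsConvergentCorrelation`, positive type of `C_∞`) into SIX registered
stubs, four thermodynamic-limit statements that are TRUE at every coupling (harmonic member included) plus the open core in the exact
vocabulary of route `CurrentTiltQuench`:

* stub 7 `stub_autocorrelationDomination` (DOM, S–M, fixed N): `|C_N(s)| ≤ B·N` for all `N`, `s ≥ 0` (Cauchy–Schwarz + `L²(π_T)`-contraction of
  the equal-temperature kernels + the landed statics `exists_integral_sq_totalCurrent_gibbsMeasure_le`);
* stub 8 `stub_infiniteVolumeWitness` (WIT, M–L): an ADMISSIBLE infinite-volume pair exists at every `T > 0` — the shift-invariant DLR state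
  `μ_T` (momentum-reversal invariant) and a BM dynamics `D` (`carrier ⊆ 𝒳₀`, preserves `μ_T`, commutes with the shift a.e.) whose current
  correlations converge ABSOLUTELY at every fixed time (`Σ_x |∫ j_0 (j_x∘φ_t) dμ_T| < ∞`: L² locality with a summable rate + independence of
  the Gaussian momenta from everything else ⇒ the far terms vanish identically up to the locality error);
* stub 9 `stub_fixedTimeThermodynamicLimit` (FTL∞, XL, HARMONIC-TRUE, the honest provable half): for every admissible pair and every lag `s ≥ 0`,
  `C_N(s)/N → C_∞(s) := D.currentCorrelation μ_T s` — the per-site equilibrium total-current autocorrelation of the OPEN chain with both baths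
  at `T` converges to the Green–Kubo integrand of the infinite chain (static window convergence `π_{N,T} → μ_T` in the bulk, dynamic L²
  locality of the open flow away from the baths, momenta independence to localise the double sum, boundary layers `O(cone(s))/N`);
* stub 10 `stub_zeroDrudeWeightInfiniteChain` (Z, THE OPEN CORE, the only stub using `lam, β > 0`): for every admissible pair,
  `τ⁻¹ ∫₀^τ C_∞(t) dt → 0` — ZERO DRUDE WEIGHT of the infinite pinned anharmonic chain (no atom of the current spectral measure at 0).
  This is VERBATIM the consequent of `CurrentTiltQuench.DrudeFromTruncation` (stmt-AtomisticToContinuum-11032) under its own hypotheses,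
  hence `Z ⟸ DrudeFromTruncation ∧ NoTruncatedDrude` (stmt-11032 ∧ stmt-11030) by modus ponens — theorem
  `zeroDrudeWeightInfiniteChain_of_currentTiltQuench` below (kernel-checked): the anharmonic content of this crux is now a FILED item of
  another route (11030, closed there by BridgeGlue from UniformQuadraticResponse / BoundedOddRigidity / QuenchCurrentDies);
* stubs 11–12 `stub_windowLimitOfPointwise`, `stub_cesaroTwoOfCesaroOne` (A1, A2; pure real analysis, S–M each): dominated convergence for
  the window functional `V(t) = 2∫₀ᵗ(t-s)C(s)ds`, and "Cesàro mean → 0 ⇒ V(t) ≤ εt² for some t > 0".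

Composition (below, no `sorry` outside `stub_*`): DOM ∧ WIT ∧ FTL∞ ∧ A1 ⇒ `FixedTimeCurrentLocality` (the strategist's child text, with
`v(t) = 2∫₀ᵗ(t-s)C_∞(s)ds`); DOM ∧ WIT ∧ FTL∞ ∧ Z ∧ A1 ∧ A2 ⇒ `ZeroDrudeWeightLiminf` (the strategist's child text; uniqueness of limits);
then p123204 ⇒ W and p123886 with (K) `BondHeatUncertainty.ExtensiveSnapshotIrreversibility` (stmt-9121, BY NAME) ⇒ the crux. So after R2
the crux is kernel-reduced to FILED ITEMS OF OTHER ROUTES — (K) 9121, `NoTruncatedDrude` 11030, `DrudeFromTruncation` 11032 — plus the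
harmonic-true thermodynamic-limit stubs DOM / WIT / FTL∞ / A1 / A2.

Disproof.lean (gen 2, re-read 2026-08-17; `-- Targets`: none) honoured: §4 anharmonicity is used in Z only (Z is FALSE for the harmonic
member: `C_∞(t) → χ_j·(per-site ballistic weight) > 0` in Cesàro mean; every other stub holds there); §7 scaling: `t(ε; lam, β, T)` of A2
blows up on the near-harmonic ray, allowed by the quantifiers (∃ N₀ after ε); §6 parity is the heuristic FOR Z (no even charge overlaps
the current; an odd quasi-conserved charge would refute Z and FouriersLaw with it); §2: the witness length is `≥ 2` (inside p123886).
-/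

noncomputable section

namespace Summit.AtomisticToContinuum.FouriersLaw.Cruxes.NonBallistic.DrudeControlsConductance

open MeasureTheory ProbabilityTheory Filter Topology
open scoped NNReal ENNReal BigOperators
open Literature.MathematicalPhysics.KineticTheory
open Literature.MathematicalPhysics.KineticTheory.HeatConduction
open Literature.Probability.Process
open Summit.AtomisticToContinuum.FouriersLaw.Theorems.BondHeatUncertainty
open Summit.AtomisticToContinuum.FouriersLaw.Theorems.JunctionLocality
open Summit.AtomisticToContinuum.FouriersLaw.Theorems.NonBallistic
open Summit.AtomisticToContinuum.FouriersLaw.Theorems.NonBallistic.DrudeLine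

/-! ## Registered stubs 1–6 (the LEVER; LANDED in R1 — p121259, p123125, p121435, p123085 (+Aux p121539/p122357), p121901, p121654 — fed
below from the tree, no `sorry`) -/

/-- **stub 1 · `stub_autocorrelationContinuous`** (planner stub 1 of both twins, VERBATIM; fixed `N`, size M; harmonic-true) =
`DrudeLine.AutocorrelationContinuous`: `s ↦ C_N(s) = ∫ J_tot·(κ_s J_tot) dπ_T` is continuous (flow continuous in time, polynomial
observable, domination from CEHR (3.4) `lintegral_exp_mul_hamiltonian_pinnedChainSemigroup_le` + `e^{θH} ∈ L¹(π_T)`). -/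
theorem stub_autocorrelationContinuous :
    ∀ ω₂ lam β γ : ℝ, 0 < ω₂ → 0 < lam → 0 < β → 0 < γ → ∀ T : ℝ, 0 < T →
    ∀ C : ℕ → ℝ → ℝ,
      C = (fun (N : ℕ) (s : ℝ) => ∫ x, (∑ i : Fin N, (pinnedChain ω₂ lam β γ).bondCurrent N i x) *
            (∫ y, (∑ i : Fin N, (pinnedChain ω₂ lam β γ).bondCurrent N i y)
              ∂((pinnedChain ω₂ lam β γ).transitionKernel N T T s.toNNReal x))
            ∂((pinnedChain ω₂ lam β γ).gibbsMeasure N T)) →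
      ∀ N : ℕ, Continuous (C N) :=
  Summit.AtomisticToContinuum.FouriersLaw.Theorems.NonBallistic.stub_autocorrelationContinuous

/-- **stub 2 · `stub_timeIntegratedCurrentMean`** (lead's split of the lever, part 1; fixed `N`, size S–M) =
`DrudeLine.TimeIntegratedCurrentMean`: `E_{μ⊗W} Φ_t = t · totalCurrent(μ)` along the stationary forward process
(`ness_facts` invariance + `EquilibriumBondHeatVariance.pinnedChain_integral_intervalIntegral_of_invariant` with `f = J_tot`). -/
theorem stub_timeIntegratedCurrentMean :
    ∀ ω₂ lam β γ : ℝ, 0 < ω₂ → 0 < lam → 0 < β → 0 < γ →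
    (∀ (N : ℕ) (T_L T_R : ℝ), 0 < T_L → 0 < T_R → ∀ μ ν : Measure (PhaseSpace N),
      (pinnedChain ω₂ lam β γ).IsSteadyState N T_L T_R μ →
      (pinnedChain ω₂ lam β γ).IsSteadyState N T_L T_R ν → μ = ν) →
    ∀ μ : (N : ℕ) → ℝ → ℝ → Measure (PhaseSpace N),
      (∀ (N : ℕ) (T_L T_R : ℝ), 0 < T_L → 0 < T_R →
        (pinnedChain ω₂ lam β γ).IsSteadyState N T_L T_R (μ N T_L T_R)) →
    ∀ N : ℕ, 2 ≤ N → ∀ (T_L T_R : ℝ), 0 < T_L → 0 < T_R → ∀ t : ℝ, 0 ≤ t →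
      Integrable (timeIntegratedCurrent (pinnedChain ω₂ lam β γ) N T_L T_R t) ((μ N T_L T_R).prod wienerPair) ∧
      ∫ zw, timeIntegratedCurrent (pinnedChain ω₂ lam β γ) N T_L T_R t zw ∂((μ N T_L T_R).prod wienerPair) =
        t * (pinnedChain ω₂ lam β γ).totalCurrent (μ N T_L T_R) :=
  Summit.AtomisticToContinuum.FouriersLaw.Theorems.NonBallistic.stub_timeIntegratedCurrentMean

/-- **stub 3 · `stub_equilibriumTimeIntegratedCurrentVariance`** (part 2; fixed `N`, size M; total-current twin of K6a) =
`DrudeLine.EquilibriumTimeIntegratedCurrentVariance`: `Φ_t ∈ L²(π_T ⊗ W)`, `Var(Φ_t) = 2∫₀ᵗ(t-s)C_N(s)ds`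
(`gibbsMeasure_bind_transitionKernel`, `pinnedChain_integral_sq_intervalIntegral_of_invariant` with `f = J_tot`, `π_T(J_tot) = 0`). -/
theorem stub_equilibriumTimeIntegratedCurrentVariance :
    ∀ ω₂ lam β γ : ℝ, 0 < ω₂ → 0 < lam → 0 < β → 0 < γ →
    (∀ (N : ℕ) (T_L T_R : ℝ), 0 < T_L → 0 < T_R → ∀ μ ν : Measure (PhaseSpace N),
      (pinnedChain ω₂ lam β γ).IsSteadyState N T_L T_R μ →
      (pinnedChain ω₂ lam β γ).IsSteadyState N T_L T_R ν → μ = ν) →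
    ∀ T : ℝ, 0 < T →
    ∀ C : ℕ → ℝ → ℝ,
      C = (fun (N : ℕ) (s : ℝ) => ∫ x, (∑ i : Fin N, (pinnedChain ω₂ lam β γ).bondCurrent N i x) *
            (∫ y, (∑ i : Fin N, (pinnedChain ω₂ lam β γ).bondCurrent N i y)
              ∂((pinnedChain ω₂ lam β γ).transitionKernel N T T s.toNNReal x))
            ∂((pinnedChain ω₂ lam β γ).gibbsMeasure N T)) →
    ∀ N : ℕ, 2 ≤ N → ∀ t : ℝ, 0 ≤ t →
      MemLp (timeIntegratedCurrent (pinnedChain ω₂ lam β γ) N T T t) 2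
          (((pinnedChain ω₂ lam β γ).gibbsMeasure N T).prod wienerPair) ∧
        variance (timeIntegratedCurrent (pinnedChain ω₂ lam β γ) N T T t)
            (((pinnedChain ω₂ lam β γ).gibbsMeasure N T).prod wienerPair) =
          2 * ∫ s in (0 : ℝ)..t, (t - s) * C N s :=
  Summit.AtomisticToContinuum.FouriersLaw.Theorems.NonBallistic.stub_equilibriumTimeIntegratedCurrentVariance

/-- **stub 4 · `stub_timeIntegratedCurrentVarianceContinuity`** (part 3; fixed `N`, size L; total-current twin of K6b
`LinearResponseFTUR.stub_bondHeatVarianceContinuity`) = `DrudeLine.TimeIntegratedCurrentVarianceContinuity`: `Var_δ(Φ_t) → Var_0(Φ_t)`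
as `δ → 0` (Helpers 1–5, 9 of K6b as they stand; Helpers 6–8 re-run with `J_tot`, dominated by `C e^{εH}`, in place of `j_b`). -/
theorem stub_timeIntegratedCurrentVarianceContinuity :
    ∀ ω₂ lam β γ : ℝ, 0 < ω₂ → 0 < lam → 0 < β → 0 < γ →
    (∀ (N : ℕ) (T_L T_R : ℝ), 0 < T_L → 0 < T_R → ∀ μ ν : Measure (PhaseSpace N),
      (pinnedChain ω₂ lam β γ).IsSteadyState N T_L T_R μ →
      (pinnedChain ω₂ lam β γ).IsSteadyState N T_L T_R ν → μ = ν) →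
    ∀ μ : (N : ℕ) → ℝ → ℝ → Measure (PhaseSpace N),
      (∀ (N : ℕ) (T_L T_R : ℝ), 0 < T_L → 0 < T_R →
        (pinnedChain ω₂ lam β γ).IsSteadyState N T_L T_R (μ N T_L T_R)) →
    ∀ T : ℝ, 0 < T → ∀ N : ℕ, 2 ≤ N → ∀ t : ℝ, 0 < t →
      (∀ᶠ δ in 𝓝[≠] (0 : ℝ), MemLp (timeIntegratedCurrent (pinnedChain ω₂ lam β γ) N (T + δ / 2) (T - δ / 2) t) 2
        ((μ N (T + δ / 2) (T - δ / 2)).prod wienerPair)) ∧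
      Tendsto (fun δ : ℝ => variance (timeIntegratedCurrent (pinnedChain ω₂ lam β γ) N (T + δ / 2) (T - δ / 2) t)
          ((μ N (T + δ / 2) (T - δ / 2)).prod wienerPair)) (𝓝[≠] 0)
        (𝓝 (variance (timeIntegratedCurrent (pinnedChain ω₂ lam β γ) N T T t) ((μ N T T).prod wienerPair))) :=
  Summit.AtomisticToContinuum.FouriersLaw.Theorems.NonBallistic.stub_timeIntegratedCurrentVarianceContinuity

/-- **stub 5 · `stub_totalHeatPathwiseIdentity`** (part 4; fixed `N`, size M, pure calculus along the flow) =
`DrudeLine.TotalHeatPathwiseIdentity`: `(N-1)Q_L - (M(z_t) - M(z)) = ∫₀ᵗ J_tot(z_s) ds` for EVERY `z, w` (block energy balances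
`∫₀ᵗ j_b = Q_L - ΔE_{≤b}`, `b ≤ N-2`; checked numerically by the lead). -/
theorem stub_totalHeatPathwiseIdentity :
    ∀ ω₂ lam β γ : ℝ, 0 < ω₂ → 0 ≤ lam → 0 ≤ β → 0 ≤ γ →
    ∀ (N : ℕ) (i0 iN ib : Fin N), 2 ≤ N → i0.val = 0 → iN.val = N - 1 →
    ∀ (T_L T_R t : ℝ), 0 ≤ t → ∀ (z : PhaseSpace N) (w : WienerPair),
      totalHeatObs (pinnedChain ω₂ lam β γ) N i0
          (rawObs (pinnedChain ω₂ lam β γ) N i0 iN ib t z (fwdPath (pinnedChain ω₂ lam β γ) N T_L T_R z w)) =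
        timeIntegratedCurrent (pinnedChain ω₂ lam β γ) N T_L T_R t (z, w) :=
  Summit.AtomisticToContinuum.FouriersLaw.Theorems.NonBallistic.stub_totalHeatPathwiseIdentity

/-- **stub 6 · `stub_totalCurrentFTURTransfer`** (part 5; size M–L) = `DrudeLine.TotalCurrentFTURTransfer`: stubs 2–5 ⇒ the planner's
`stub_totalCurrentFTUR` verbatim (HVV FTUR on `Obs N` with `φ = totalHeatObs`, (★)'s entropy balance and steady heat rates, transport
to `Φ_t` by stub 5, `shape_of_hvv_family` on the `(N-1)`-rescaled family). -/
theorem stub_totalCurrentFTURTransfer :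
    TimeIntegratedCurrentMean → EquilibriumTimeIntegratedCurrentVariance → TimeIntegratedCurrentVarianceContinuity →
      TotalHeatPathwiseIdentity → TotalCurrentFTUR :=
  Summit.AtomisticToContinuum.FouriersLaw.Theorems.NonBallistic.stub_totalCurrentFTURTransfer

/-! ## Reshape R2 (lead c3): the cut of W along the tree's infinite-chain library — stubs 7–12 (open) -/

/-- **stub 7 · `stub_autocorrelationDomination`** (DOM; fixed `N`, size S–M; harmonic-true): the equilibrium total-current
autocorrelation is dominated `N`-uniformly, `|C_N(s)| ≤ B·N` for all `N` and `s ≥ 0` (Cauchy–Schwarz in `L²(π_T)`, the equal-temperature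
kernels are `L²(π_T)`-contractions because `π_T` is invariant (`pinnedChain_gibbsMeasure_bind_transitionKernel`, uniqueness from
`nessUnique_proof`), and the landed statics `exists_integral_sq_totalCurrent_gibbsMeasure_le`: `∫ J_tot² dπ_T ≤ C_J N`). -/
theorem stub_autocorrelationDomination :
    ∀ ω₂ lam β γ : ℝ, 0 < ω₂ → 0 < lam → 0 < β → 0 < γ → ∀ T : ℝ, 0 < T →
    ∀ C : ℕ → ℝ → ℝ,
      C = (fun (N : ℕ) (s : ℝ) => ∫ x, (∑ i : Fin N, (pinnedChain ω₂ lam β γ).bondCurrent N i x) *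
            (∫ y, (∑ i : Fin N, (pinnedChain ω₂ lam β γ).bondCurrent N i y)
              ∂((pinnedChain ω₂ lam β γ).transitionKernel N T T s.toNNReal x))
            ∂((pinnedChain ω₂ lam β γ).gibbsMeasure N T)) →
      ∃ B : ℝ, ∀ N : ℕ, ∀ s : ℝ, 0 ≤ s → |C N s| ≤ B * (N : ℝ) :=
  Summit.AtomisticToContinuum.FouriersLaw.Theorems.NonBallistic.stub_autocorrelationDomination

/-- **stub 8 · `stub_infiniteVolumeWitness`** (WIT; size M–L; harmonic-true): at every `T > 0` the infinite pinned chain has an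
ADMISSIBLE PAIR — a shift-invariant, momentum-reversal-invariant DLR Gibbs state `μ` at `T`
(`exists_isChainGibbsMeasure_shiftInvariant_superstable_pinnedChain`, uniqueness `eq_of_isChainGibbsMeasure_of_isShiftInvariant_pinnedChain`)
and a Buttà–Marchioro dynamics `D` (`OscillatorChain.exists_bmDynamics`: carrier `𝒳₀ = bmGood`, preserves every superstable DLR state,
commutes with the shift a.e. `flow_comp_chainShift_ae_of_carrier_subset_bmGood`) — whose current correlations converge ABSOLUTELY at every
time: `Σ_x |∫ j_0 (j_x ∘ φ_t) dμ| < ∞` (fixed-time L² locality with a summable rate, `InfiniteChainL2Locality.exists_summable_l2_locality`, and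
independence of the Gaussian momenta from the position field, `InfiniteChainGibbsMomentaIndependence`: the pairing of `j_0` with a local
approximant of `j_x ∘ φ_t` not touching `p_0, p_1` vanishes identically). -/
theorem stub_infiniteVolumeWitness :
    ∀ ω₂ lam β γ : ℝ, 0 < ω₂ → 0 < lam → 0 < β → 0 < γ → ∀ T : ℝ, 0 < T →
      ∃ (μ : Measure ChainConfig) (D : InfiniteChainDynamics (pinnedChain ω₂ lam β γ)),
        (pinnedChain ω₂ lam β γ).IsChainGibbsMeasure T μ ∧ IsShiftInvariant μ ∧
        μ.map (fun σ : ChainConfig => fun x : ℤ => ((σ x).1, -(σ x).2)) = μ ∧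
        D.carrier ⊆ (pinnedChain ω₂ lam β γ).bmGood ∧ D.PreservesMeasure μ ∧
        (∀ t : ℝ, ∀ᵐ σ ∂μ, D.flow t (shift σ) = shift (D.flow t σ)) ∧
        (∀ t : ℝ, D.HasAbsConvergentCorrelation μ t) :=
  Summit.AtomisticToContinuum.FouriersLaw.Theorems.NonBallistic.stub_infiniteVolumeWitness

/-! ## Reshape R2b (lead c3, after wave 1): FTL∞ (stub 9) cut along the LANDED open/closed matching pipeline of line
`loomis-compact-horizon-witness` (crux EmbeddedDrudeMourre.AbelThermodynamicLimit, stmt-12596: `stub_fixedTimeOffsetMatching` =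
central-anchor fixed-time matching, from `stub_centralWindowEnsembleEquivalence` (static) + `stub_centralWindowDynamicalMatching`
(two-dynamics light cone) + `stub_fixedTimeOffsetMatchingOfLeaves`; plus the ANCHOR-UNIFORM `uniformAnchoredCorrelationTails` and
`BulkWindow.pinnedChain_bulkWindow_event`). FTL∞ needs the same matching UNIFORMLY OVER BULK ANCHORS (it averages over all bonds), so: -/

/-- **stub 13 · `stub_bulkWindowDynamicalMatching`** (F1a; size XL−, mechanical; harmonic-true): the TWO-DYNAMICS LIGHT CONE AT FIXED
TIME for BULK windows, uniformly in `N` and in the anchor — VERBATIM `stub_centralWindowDynamicalMatching` (landed, file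
`EmbeddedDrudeMourreAbelThermodynamicLimitDynamicalMatching.lean`) with the centred embedding `ι_N` (anchor `(N-1)/2`, `2R+4 ≤ N`) replaced by
the embedding `ι_{N,a}` anchored at an arbitrary bond `a` with `R + 1 ≤ a`, `a + R + 3 ≤ N` (window `[a-R-1, a+R+1]` inside the chain): the
current `j_x` of the embedded open-chain path at time `t` and of the severed Hamiltonian flow of the box `{-R,…,R}` from the same Gibbs
configuration differ by `> ε` with probability `≤ ε` under `gibbsMeasure N T ⊗ W`. Port of the five `…DynamicalMatching*.lean` files with an
anchor parameter (pathwise core is anchor-free; energy mean / bad event / radius use SITE-uniform Gibbs moments and stationarity). -/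
theorem stub_bulkWindowDynamicalMatching :
    ∀ ω₂ lam β γ : ℝ, 0 < ω₂ → 0 < lam → 0 < β → 0 < γ → ∀ T : ℝ, 0 < T →
          ∀ (hB1 : (pinnedChain ω₂ lam β γ).CondB1)
            (ι : (N : ℕ) → ℕ → PhaseSpace N → ChainConfig),
            (∀ (N a : ℕ) (z : PhaseSpace N) (i : ℤ),
              ι N a z i = if h : 0 ≤ i + (a : ℤ) ∧ i + (a : ℤ) < N then
                (z.1 ⟨(i + (a : ℤ)).toNat, by omega⟩, z.2 ⟨(i + (a : ℤ)).toNat, by omega⟩)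
                else (0, 0)) →
          ∀ (t : ℝ), 0 ≤ t → ∀ (x : ℤ) (ε : ℝ), 0 < ε → ∃ R₀ : ℕ, ∀ R : ℕ, R₀ ≤ R →
            ∀ N a : ℕ, R + 1 ≤ a → a + R + 3 ≤ N →
            (((pinnedChain ω₂ lam β γ).gibbsMeasure N T).prod wienerPair)
              {q : PhaseSpace N × WienerPair |
                ε < |(pinnedChain ω₂ lam β γ).bondCurrentZ
                      (ι N a ((pinnedChain ω₂ lam β γ).solMap N T T t q.1 (pairPath q.2))) x -
                    (pinnedChain ω₂ lam β γ).bondCurrentZ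
                      (OscillatorChain.severedFlow hB1 (Finset.Icc (-(R : ℤ)) R) t (ι N a q.1)) x|} ≤ ENNReal.ofReal ε :=
  Summit.AtomisticToContinuum.FouriersLaw.Theorems.NonBallistic.stub_bulkWindowDynamicalMatching

/-- **stub 14 · `stub_bulkAnchorMatchingOfDynamicalMatching`** (F1′; size L–XL, mechanical; harmonic-true): F1a ⇒ ANCHOR-UNIFORM FIXED-TIME
PER-OFFSET MATCHING in the bulk — for every admissible pair, offset `x`, time `t ≥ 0` and `ε > 0` there are `L, N₀` with
`|⟨j_a(0) j_{a+x}(t)⟩_{N,T} - ∫ j_0 (j_x ∘ φ_t) dμ| ≤ ε` for all `N ≥ N₀` and all anchors `a` with `L ≤ a`, `a + L < N`. Port of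
`stub_fixedTimeOffsetMatchingOfLeaves` (+ `…ProductForm`; `…SeveredLimit` is anchor-free and reusable as is) in the uniform quantifier
shape, with the static half supplied by the landed anchor-uniform `BulkWindow.pinnedChain_bulkWindow_event`
(LatticeLandauDampingAbelThermodynamicLimitBulkWindowEquivalence.lean) and the dynamic half by F1a (hypothesis). -/
theorem stub_bulkAnchorMatchingOfDynamicalMatching :
    (∀ ω₂ lam β γ : ℝ, 0 < ω₂ → 0 < lam → 0 < β → 0 < γ → ∀ T : ℝ, 0 < T →
          ∀ (hB1 : (pinnedChain ω₂ lam β γ).CondB1)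
            (ι : (N : ℕ) → ℕ → PhaseSpace N → ChainConfig),
            (∀ (N a : ℕ) (z : PhaseSpace N) (i : ℤ),
              ι N a z i = if h : 0 ≤ i + (a : ℤ) ∧ i + (a : ℤ) < N then
                (z.1 ⟨(i + (a : ℤ)).toNat, by omega⟩, z.2 ⟨(i + (a : ℤ)).toNat, by omega⟩)
                else (0, 0)) →
          ∀ (t : ℝ), 0 ≤ t → ∀ (x : ℤ) (ε : ℝ), 0 < ε → ∃ R₀ : ℕ, ∀ R : ℕ, R₀ ≤ R →
            ∀ N a : ℕ, R + 1 ≤ a → a + R + 3 ≤ N →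
            (((pinnedChain ω₂ lam β γ).gibbsMeasure N T).prod wienerPair)
              {q : PhaseSpace N × WienerPair |
                ε < |(pinnedChain ω₂ lam β γ).bondCurrentZ
                      (ι N a ((pinnedChain ω₂ lam β γ).solMap N T T t q.1 (pairPath q.2))) x -
                    (pinnedChain ω₂ lam β γ).bondCurrentZ
                      (OscillatorChain.severedFlow hB1 (Finset.Icc (-(R : ℤ)) R) t (ι N a q.1)) x|} ≤ ENNReal.ofReal ε) →
    ∀ ω₂ lam β γ : ℝ, 0 < ω₂ → 0 < lam → 0 < β → 0 < γ → ∀ T : ℝ, 0 < T →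
          ∀ (μ : Measure ChainConfig) (D : InfiniteChainDynamics (pinnedChain ω₂ lam β γ)),
            (pinnedChain ω₂ lam β γ).IsChainGibbsMeasure T μ → IsShiftInvariant μ →
            D.carrier ⊆ (pinnedChain ω₂ lam β γ).bmGood → D.PreservesMeasure μ →
            (∀ t : ℝ, D.HasAbsConvergentCorrelation μ t) →
            ∀ (x : ℤ) (t : ℝ), 0 ≤ t → ∀ ε : ℝ, 0 < ε → ∃ L N₀ : ℕ, ∀ N : ℕ, N₀ ≤ N →
              ∀ a : ℕ, L ≤ a → a + L < N →
              |(if h : 0 ≤ (a : ℤ) + x ∧ (a : ℤ) + x < N ∧ a < N then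
                  ∫ z, (pinnedChain ω₂ lam β γ).bondCurrent N ⟨a, h.2.2⟩ z *
                    (∫ y, (pinnedChain ω₂ lam β γ).bondCurrent N ⟨((a : ℤ) + x).toNat, by omega⟩ y
                      ∂((pinnedChain ω₂ lam β γ).transitionKernel N T T t.toNNReal z))
                    ∂((pinnedChain ω₂ lam β γ).gibbsMeasure N T)
                else 0) -
                ∫ σ, (pinnedChain ω₂ lam β γ).bondCurrentZ σ 0 * (pinnedChain ω₂ lam β γ).bondCurrentZ (D.flow t σ) x ∂μ| ≤ ε :=
  Summit.AtomisticToContinuum.FouriersLaw.Theorems.NonBallistic.stub_bulkAnchorMatchingOfDynamicalMatching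

/-- **stub 15 · `stub_fixedTimeThermodynamicLimitOfBulkMatching`** (F2; size L; harmonic-true): anchor-uniform matching (F1) ⇒ FTL∞.
`C_N(s) = Σ_{i,k} A_{ik}(s)`, `A_{ik} = ⟨j_i(0) j_k(s)⟩_{N,T}`; near-end rows (`i < L` or `i + L ≥ N`) contribute `O(√(L·N))` by Cauchy–Schwarz
with the block statics `‖Σ_{i∈E} j_i‖² ≤ C|E|` (`SubBallisticWindow…stub_staticCurrentBound`) and the `L²(π_T)`-contraction of `κ_s`; bulk rows:
tails `Σ_{|k-i|>R} |A_{ik}| ≤ η` uniformly (`uniformAnchoredCorrelationTails`, landed, anchor-uniform), window terms `A_{i,i+x} → a_x(s)` uniformly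
(F1), and `Σ_{|x|≤R} a_x(s) → C_∞(s)` (`HasAbsConvergentCorrelation`, hypothesis); so `C_N(s)/N → C_∞(s)`. -/
theorem stub_fixedTimeThermodynamicLimitOfBulkMatching :
    (∀ ω₂ lam β γ : ℝ, 0 < ω₂ → 0 < lam → 0 < β → 0 < γ → ∀ T : ℝ, 0 < T →
          ∀ (μ : Measure ChainConfig) (D : InfiniteChainDynamics (pinnedChain ω₂ lam β γ)),
            (pinnedChain ω₂ lam β γ).IsChainGibbsMeasure T μ → IsShiftInvariant μ →
            D.carrier ⊆ (pinnedChain ω₂ lam β γ).bmGood → D.PreservesMeasure μ →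
            (∀ t : ℝ, D.HasAbsConvergentCorrelation μ t) →
            ∀ (x : ℤ) (t : ℝ), 0 ≤ t → ∀ ε : ℝ, 0 < ε → ∃ L N₀ : ℕ, ∀ N : ℕ, N₀ ≤ N →
              ∀ a : ℕ, L ≤ a → a + L < N →
              |(if h : 0 ≤ (a : ℤ) + x ∧ (a : ℤ) + x < N ∧ a < N then
                  ∫ z, (pinnedChain ω₂ lam β γ).bondCurrent N ⟨a, h.2.2⟩ z *
                    (∫ y, (pinnedChain ω₂ lam β γ).bondCurrent N ⟨((a : ℤ) + x).toNat, by omega⟩ y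
                      ∂((pinnedChain ω₂ lam β γ).transitionKernel N T T t.toNNReal z))
                    ∂((pinnedChain ω₂ lam β γ).gibbsMeasure N T)
                else 0) -
                ∫ σ, (pinnedChain ω₂ lam β γ).bondCurrentZ σ 0 * (pinnedChain ω₂ lam β γ).bondCurrentZ (D.flow t σ) x ∂μ| ≤ ε) →
    ∀ ω₂ lam β γ : ℝ, 0 < ω₂ → 0 < lam → 0 < β → 0 < γ → ∀ T : ℝ, 0 < T →
        ∀ C : ℕ → ℝ → ℝ,
          C = (fun (N : ℕ) (s : ℝ) => ∫ x, (∑ i : Fin N, (pinnedChain ω₂ lam β γ).bondCurrent N i x) *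
                (∫ y, (∑ i : Fin N, (pinnedChain ω₂ lam β γ).bondCurrent N i y)
                  ∂((pinnedChain ω₂ lam β γ).transitionKernel N T T s.toNNReal x))
                ∂((pinnedChain ω₂ lam β γ).gibbsMeasure N T)) →
          ∀ (μ : Measure ChainConfig) (D : InfiniteChainDynamics (pinnedChain ω₂ lam β γ)),
            (pinnedChain ω₂ lam β γ).IsChainGibbsMeasure T μ → IsShiftInvariant μ →
            D.carrier ⊆ (pinnedChain ω₂ lam β γ).bmGood → D.PreservesMeasure μ →
            (∀ t : ℝ, D.HasAbsConvergentCorrelation μ t) →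
            ∀ s : ℝ, 0 ≤ s →
              Tendsto (fun N : ℕ => C N s / (N : ℝ)) atTop (𝓝 (D.currentCorrelation μ s)) :=
  Summit.AtomisticToContinuum.FouriersLaw.Theorems.NonBallistic.stub_fixedTimeThermodynamicLimitOfBulkMatching

/-- **stub 9 · `stub_fixedTimeThermodynamicLimit`** (FTL∞; HARMONIC-TRUE — the honest provable half of W; after R2b NO LONGER A STUB: derived below
from stubs 13–15, F2 (F1′ F1a)): for every admissible pair
(shift-invariant DLR state `μ` at `T`, dynamics with carrier in `𝒳₀` preserving `μ`, absolutely convergent correlations) and every lag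
`s ≥ 0`, the per-site equilibrium total-current autocorrelation of the OPEN chain with both baths at `T` converges to the Green–Kubo
integrand of the infinite chain: `C_N(s)/N → C_∞(s) = D.currentCorrelation μ s = Σ_x ∫ j_0 (j_x ∘ φ_s) dμ`. Ingredients: momenta independence
localises the double sum `Σ_{i,k} ⟨j_i, κ_s j_k⟩` to `|i-k| ≤ n+2` up to the L² locality error of `κ_s j_k`; dynamic L² locality of the open
(bathed) flow away from the baths, `N`-uniform (common-noise propagation `JunctionLocalityNonBallisticLightConePropagation` + Gibbs tails);
static convergence of bulk window marginals of `π_{N,T}` to `μ` (transfer operator, `InfiniteChainClusteringTransfer` / window kernels);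
boundary layers contribute `O(n + cone(s))`, i.e. `o(N)`. -/
theorem stub_fixedTimeThermodynamicLimit :
    ∀ ω₂ lam β γ : ℝ, 0 < ω₂ → 0 < lam → 0 < β → 0 < γ → ∀ T : ℝ, 0 < T →
    ∀ C : ℕ → ℝ → ℝ,
      C = (fun (N : ℕ) (s : ℝ) => ∫ x, (∑ i : Fin N, (pinnedChain ω₂ lam β γ).bondCurrent N i x) *
            (∫ y, (∑ i : Fin N, (pinnedChain ω₂ lam β γ).bondCurrent N i y)
              ∂((pinnedChain ω₂ lam β γ).transitionKernel N T T s.toNNReal x))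
            ∂((pinnedChain ω₂ lam β γ).gibbsMeasure N T)) →
      ∀ (μ : Measure ChainConfig) (D : InfiniteChainDynamics (pinnedChain ω₂ lam β γ)),
        (pinnedChain ω₂ lam β γ).IsChainGibbsMeasure T μ → IsShiftInvariant μ →
        D.carrier ⊆ (pinnedChain ω₂ lam β γ).bmGood → D.PreservesMeasure μ →
        (∀ t : ℝ, D.HasAbsConvergentCorrelation μ t) →
        ∀ s : ℝ, 0 ≤ s →
          Tendsto (fun N : ℕ => C N s / (N : ℝ)) atTop (𝓝 (D.currentCorrelation μ s)) :=
  stub_fixedTimeThermodynamicLimitOfBulkMatching (stub_bulkAnchorMatchingOfDynamicalMatching stub_bulkWindowDynamicalMatching)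

/-! ## Reshape R3b (lead c3, after wave 2): the open core in REGULAR-WITNESS form, and its provable half

Route `CurrentTiltQuench` supplies zero Drude weight as 11032 ∧ 11030, both quantified over ALL `μ`-preserving dynamics `D`. For a `D` whose
carrier is not inside `𝒳₀ = bmGood` the identification of `D.flow t` with the Buttà–Marchioro flow a.e. needs the a.e.-ORBIT inclusion
(uncountably many times; flagged unproved as "F2" by the lead of crux EmbeddedDrudeMourre.GreenKuboContinuation,
`Theorems/EmbeddedDrudeMourreGreenKuboContinuationCanonicalSeed.lean` §2). This line only ever applies zero Drude weight to the REGULAR witness of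
`stub_infiniteVolumeWitness` (`D.carrier ⊆ 𝒳₀`), so both the open core and its provable half are registered with that side condition — WEAKER
statements, still implied by 11032 ∧ 11030 verbatim (`…_of_currentTiltQuench` below), and free of the pathology. -/

/-- **stub 16 · `stub_drudeFromTruncationRegular`** (DFT′; LANDED p155805 (+Aux p153679 p155211 p155617), wave 3; harmonic-TRUE): `CurrentTiltQuench.DrudeFromTruncation`
(stmt-AtomisticToContinuum-11032) RESTRICTED to regular dynamics (`D.carrier ⊆ 𝒳₀`): for a shift-invariant, reversal-invariant DLR state `μ` at
`T`, a regular `μ`-preserving dynamics commuting with the shift a.e. with absolutely convergent current correlations, vanishing of all TRUNCATED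
Drude weights (the `NoTruncatedDrude` body) implies zero Drude weight `τ⁻¹∫₀^τ C_∞ → 0`. Scheme: transfer to the BM dynamics (carrier `= 𝒳₀`,
`flow_eq_of_carrier_subset_bmGood`, `currentCorrelation_eq_of_carrier_subset`); write `C(t) = ⟨⟨j, j∘φ_t⟩⟩`, `⟨⟨f, g⟩⟩ := Σ_x Cov(f∘τ_x, g)` (Spohn's
zero-wavenumber form on quasi-local `L²` observables with summable covariances); split `j = F_M(j) + r_M`; the three remainder terms are
`≤ ‖r_M‖(2‖F_M j‖ + ‖r_M‖)` in the `⟨⟨·,·⟩⟩`-seminorm UNIFORMLY IN `t` by the Følner Cauchy–Schwarz (`FluctuationFoelnerPositivity`) and the isometry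
`⟨⟨g∘φ_t, g∘φ_t⟩⟩ = ⟨⟨g, g⟩⟩` (invariance + shift commutation), with `⟨⟨r_M, r_M⟩⟩ = Σ_{|x|≤2} Cov(r_M∘τ_x, r_M) ≤ 5 E[j⁴]/M²` (exact orthogonality of
currents at distance `≥ 2` by partial momentum reversal; clip is odd); the main term `τ⁻¹∫₀^τ ⟨⟨F_M j, (F_M j)∘φ_t⟩⟩` is the `L → ∞` limit of the
hypothesis' `τ⁻¹∫₀^τ Cov(G_L, F_M(j_0)∘φ_t)` at FIXED `τ` (dominated convergence: `Σ_x |Cov(F_M j_x, F_M(j_0)∘φ_t)| ≤ ‖F_M j‖₂ Σ_n ε_n(τ) + 7‖F_M j‖₂²`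
uniformly on `t ∈ [0, τ]` by fixed-horizon L² locality `exists_summable_l2_locality` + exact orthogonality). -/
theorem stub_drudeFromTruncationRegular :
    ∀ ω₂ lam β γ : ℝ, 0 < ω₂ → 0 < lam → 0 < β → ∀ T : ℝ, 0 < T →
      ∀ μ : Measure ChainConfig, (pinnedChain ω₂ lam β γ).IsChainGibbsMeasure T μ → IsShiftInvariant μ →
        μ.map (fun σ : ChainConfig => fun x : ℤ => ((σ x).1, -(σ x).2)) = μ →
        ∀ D : InfiniteChainDynamics (pinnedChain ω₂ lam β γ), D.carrier ⊆ (pinnedChain ω₂ lam β γ).bmGood →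
          D.PreservesMeasure μ →
          (∀ t : ℝ, ∀ᵐ σ ∂μ, D.flow t (shift σ) = shift (D.flow t σ)) →
          (∀ t : ℝ, D.HasAbsConvergentCorrelation μ t) →
          (∀ M : ℝ, 0 < M → ∀ F : ℝ → ℝ, F = (fun u : ℝ => max (-M) (min M u)) → ∀ η : ℝ, 0 < η →
            ∃ τ₀ : ℝ, ∀ τ : ℝ, τ₀ ≤ τ → ∃ L₀ : ℕ, ∀ L : ℕ, L₀ ≤ L →
              ∀ G : ChainConfig → ℝ,
                G = (fun σ : ChainConfig => ∑ x ∈ Finset.Icc (-(L : ℤ)) (L : ℤ), F ((pinnedChain ω₂ lam β γ).bondCurrentZ σ x)) →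
                |(τ⁻¹ * ∫ t in (0:ℝ)..τ, ((∫ σ, F ((pinnedChain ω₂ lam β γ).bondCurrentZ (D.flow t σ) 0) * G σ ∂μ) -
                  (∫ σ, F ((pinnedChain ω₂ lam β γ).bondCurrentZ (D.flow t σ) 0) ∂μ) * (∫ σ, G σ ∂μ)))| ≤ η) →
          Tendsto (fun τ : ℝ => τ⁻¹ * ∫ t in (0:ℝ)..τ, D.currentCorrelation μ t) atTop (𝓝 0) :=
  Summit.AtomisticToContinuum.FouriersLaw.Theorems.NonBallistic.stub_drudeFromTruncationRegular

/-- **stub 10 · `stub_zeroDrudeWeightRegular`** (Z′; THE OPEN CORE, lead; the ONLY statement of the line using `lam, β > 0`): ZERO DRUDE WEIGHT of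
the infinite pinned anharmonic chain along REGULAR witnesses — for every shift-invariant, momentum-reversal-invariant DLR state `μ` at `T > 0` and
every regular (`carrier ⊆ 𝒳₀`) `μ`-preserving dynamics commuting with the shift a.e. whose current correlations converge absolutely, the Cesàro
mean of the Green–Kubo integrand vanishes: `τ⁻¹ ∫₀^τ C_∞(t) dt → 0` (no atom of the current spectral measure at frequency 0). `= DFT′ ∧`
`CurrentTiltQuench.NoTruncatedDrude` (stmt-11030); implied by 11032 ∧ 11030 verbatim. FALSE for the harmonic member (phonon Drude peak,
`C_∞(t) → 2D_harm > 0` in Cesàro mean): Disproof §4 is honoured here and only here. -/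
theorem stub_zeroDrudeWeightRegular :
    ∀ ω₂ lam β γ : ℝ, 0 < ω₂ → 0 < lam → 0 < β → ∀ T : ℝ, 0 < T →
      ∀ μ : Measure ChainConfig, (pinnedChain ω₂ lam β γ).IsChainGibbsMeasure T μ → IsShiftInvariant μ →
        μ.map (fun σ : ChainConfig => fun x : ℤ => ((σ x).1, -(σ x).2)) = μ →
        ∀ D : InfiniteChainDynamics (pinnedChain ω₂ lam β γ), D.carrier ⊆ (pinnedChain ω₂ lam β γ).bmGood →
          D.PreservesMeasure μ →
          (∀ t : ℝ, ∀ᵐ σ ∂μ, D.flow t (shift σ) = shift (D.flow t σ)) →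
          (∀ t : ℝ, D.HasAbsConvergentCorrelation μ t) →
          Tendsto (fun τ : ℝ => τ⁻¹ * ∫ t in (0:ℝ)..τ, D.currentCorrelation μ t) atTop (𝓝 0) := by
  sorry

/-- **stub 11 · `stub_windowLimitOfPointwise`** (A1; pure real analysis, size S–M): dominated convergence for the window functional — if
`f_N` are continuous, `|f_N(s)| ≤ B·N` on `s ≥ 0`, and `f_N(s)/N → g(s)` for every `s ≥ 0` with `g` measurable, then for every `t > 0`
`(2∫₀ᵗ (t-s) f_N(s) ds)/N → 2∫₀ᵗ (t-s) g(s) ds`. -/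
theorem stub_windowLimitOfPointwise :
    ∀ (f : ℕ → ℝ → ℝ) (g : ℝ → ℝ) (B : ℝ), (∀ N : ℕ, Continuous (f N)) → Measurable g →
      (∀ N : ℕ, ∀ s : ℝ, 0 ≤ s → |f N s| ≤ B * (N : ℝ)) →
      (∀ s : ℝ, 0 ≤ s → Tendsto (fun N : ℕ => f N s / (N : ℝ)) atTop (𝓝 (g s))) →
      ∀ t : ℝ, 0 < t →
        Tendsto (fun N : ℕ => (2 * ∫ s in (0 : ℝ)..t, (t - s) * f N s) / (N : ℝ)) atTop
          (𝓝 (2 * ∫ s in (0 : ℝ)..t, (t - s) * g s)) :=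
  Summit.AtomisticToContinuum.FouriersLaw.Theorems.NonBallistic.stub_windowLimitOfPointwise

/-- **stub 12 · `stub_cesaroTwoOfCesaroOne`** (A2; pure real analysis, size S–M): if `g` is measurable, `|g| ≤ B` on `s ≥ 0` and its Cesàro
mean vanishes, `τ⁻¹∫₀^τ g → 0`, then the window functional is eventually sub-quadratic: for every `ε > 0` some `t > 0` has
`2∫₀ᵗ (t-s) g(s) ds ≤ ε t²` (`∫₀ᵗ (t-s) g = ∫₀ᵗ G`, `G(s) = ∫₀ˢ g = o(s)`). -/
theorem stub_cesaroTwoOfCesaroOne :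
    ∀ (g : ℝ → ℝ) (B : ℝ), Measurable g → (∀ s : ℝ, 0 ≤ s → |g s| ≤ B) →
      Tendsto (fun τ : ℝ => τ⁻¹ * ∫ t in (0:ℝ)..τ, g t) atTop (𝓝 0) →
      ∀ ε : ℝ, 0 < ε → ∃ t : ℝ, 0 < t ∧ (2 * ∫ s in (0 : ℝ)..t, (t - s) * g s) ≤ ε * t ^ 2 :=
  Summit.AtomisticToContinuum.FouriersLaw.Theorems.NonBallistic.stub_cesaroTwoOfCesaroOne

/-! ## Name-keyed aliases of the statements (the hypothesis types of the composition)

`Registered.stub_<name>` is by definition the statement of `stub_<name>` (stubs 1–6: the named `Prop`s of the Defs file; stubs 7–12: spelled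
here); the skeleton audit admits a `Prop` hypothesis whose head constant carries a stub's name, and the route item (K)
`BondHeatUncertainty.ExtensiveSnapshotIrreversibility` (stmt-9121) by its own name. -/
namespace Registered

/-- Statement of `stub_autocorrelationContinuous`. -/
abbrev stub_autocorrelationContinuous : Prop := AutocorrelationContinuous
/-- Statement of `stub_timeIntegratedCurrentMean`. -/
abbrev stub_timeIntegratedCurrentMean : Prop := TimeIntegratedCurrentMean
/-- Statement of `stub_equilibriumTimeIntegratedCurrentVariance`. -/
abbrev stub_equilibriumTimeIntegratedCurrentVariance : Prop := EquilibriumTimeIntegratedCurrentVariance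
/-- Statement of `stub_timeIntegratedCurrentVarianceContinuity`. -/
abbrev stub_timeIntegratedCurrentVarianceContinuity : Prop := TimeIntegratedCurrentVarianceContinuity
/-- Statement of `stub_totalHeatPathwiseIdentity`. -/
abbrev stub_totalHeatPathwiseIdentity : Prop := TotalHeatPathwiseIdentity
/-- Statement of `stub_totalCurrentFTURTransfer`. -/
abbrev stub_totalCurrentFTURTransfer : Prop := TotalCurrentFTURTransfer

/-- Statement of `stub_autocorrelationDomination` (DOM). -/
def stub_autocorrelationDomination : Prop :=
    ∀ ω₂ lam β γ : ℝ, 0 < ω₂ → 0 < lam → 0 < β → 0 < γ → ∀ T : ℝ, 0 < T →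
    ∀ C : ℕ → ℝ → ℝ,
      C = (fun (N : ℕ) (s : ℝ) => ∫ x, (∑ i : Fin N, (pinnedChain ω₂ lam β γ).bondCurrent N i x) *
            (∫ y, (∑ i : Fin N, (pinnedChain ω₂ lam β γ).bondCurrent N i y)
              ∂((pinnedChain ω₂ lam β γ).transitionKernel N T T s.toNNReal x))
            ∂((pinnedChain ω₂ lam β γ).gibbsMeasure N T)) →
      ∃ B : ℝ, ∀ N : ℕ, ∀ s : ℝ, 0 ≤ s → |C N s| ≤ B * (N : ℝ)

/-- Statement of `stub_infiniteVolumeWitness` (WIT). -/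
def stub_infiniteVolumeWitness : Prop :=
    ∀ ω₂ lam β γ : ℝ, 0 < ω₂ → 0 < lam → 0 < β → 0 < γ → ∀ T : ℝ, 0 < T →
      ∃ (μ : Measure ChainConfig) (D : InfiniteChainDynamics (pinnedChain ω₂ lam β γ)),
        (pinnedChain ω₂ lam β γ).IsChainGibbsMeasure T μ ∧ IsShiftInvariant μ ∧
        μ.map (fun σ : ChainConfig => fun x : ℤ => ((σ x).1, -(σ x).2)) = μ ∧
        D.carrier ⊆ (pinnedChain ω₂ lam β γ).bmGood ∧ D.PreservesMeasure μ ∧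
        (∀ t : ℝ, ∀ᵐ σ ∂μ, D.flow t (shift σ) = shift (D.flow t σ)) ∧
        (∀ t : ℝ, D.HasAbsConvergentCorrelation μ t)

/-- Statement of `stub_fixedTimeThermodynamicLimit` (FTL∞). -/
def stub_fixedTimeThermodynamicLimit : Prop :=
    ∀ ω₂ lam β γ : ℝ, 0 < ω₂ → 0 < lam → 0 < β → 0 < γ → ∀ T : ℝ, 0 < T →
    ∀ C : ℕ → ℝ → ℝ,
      C = (fun (N : ℕ) (s : ℝ) => ∫ x, (∑ i : Fin N, (pinnedChain ω₂ lam β γ).bondCurrent N i x) *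
            (∫ y, (∑ i : Fin N, (pinnedChain ω₂ lam β γ).bondCurrent N i y)
              ∂((pinnedChain ω₂ lam β γ).transitionKernel N T T s.toNNReal x))
            ∂((pinnedChain ω₂ lam β γ).gibbsMeasure N T)) →
      ∀ (μ : Measure ChainConfig) (D : InfiniteChainDynamics (pinnedChain ω₂ lam β γ)),
        (pinnedChain ω₂ lam β γ).IsChainGibbsMeasure T μ → IsShiftInvariant μ →
        D.carrier ⊆ (pinnedChain ω₂ lam β γ).bmGood → D.PreservesMeasure μ →
        (∀ t : ℝ, D.HasAbsConvergentCorrelation μ t) →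
        ∀ s : ℝ, 0 ≤ s →
          Tendsto (fun N : ℕ => C N s / (N : ℝ)) atTop (𝓝 (D.currentCorrelation μ s))

/-- Statement of `stub_zeroDrudeWeightRegular` (Z′, the open core in regular-witness form). -/
def stub_zeroDrudeWeightRegular : Prop :=
    ∀ ω₂ lam β γ : ℝ, 0 < ω₂ → 0 < lam → 0 < β → ∀ T : ℝ, 0 < T →
      ∀ μ : Measure ChainConfig, (pinnedChain ω₂ lam β γ).IsChainGibbsMeasure T μ → IsShiftInvariant μ →
        μ.map (fun σ : ChainConfig => fun x : ℤ => ((σ x).1, -(σ x).2)) = μ →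
        ∀ D : InfiniteChainDynamics (pinnedChain ω₂ lam β γ), D.carrier ⊆ (pinnedChain ω₂ lam β γ).bmGood →
          D.PreservesMeasure μ →
          (∀ t : ℝ, ∀ᵐ σ ∂μ, D.flow t (shift σ) = shift (D.flow t σ)) →
          (∀ t : ℝ, D.HasAbsConvergentCorrelation μ t) →
          Tendsto (fun τ : ℝ => τ⁻¹ * ∫ t in (0:ℝ)..τ, D.currentCorrelation μ t) atTop (𝓝 0)

/-- Statement of `stub_drudeFromTruncationRegular` (DFT′ = stmt-11032 restricted to regular dynamics). -/
def stub_drudeFromTruncationRegular : Prop :=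
    ∀ ω₂ lam β γ : ℝ, 0 < ω₂ → 0 < lam → 0 < β → ∀ T : ℝ, 0 < T →
      ∀ μ : Measure ChainConfig, (pinnedChain ω₂ lam β γ).IsChainGibbsMeasure T μ → IsShiftInvariant μ →
        μ.map (fun σ : ChainConfig => fun x : ℤ => ((σ x).1, -(σ x).2)) = μ →
        ∀ D : InfiniteChainDynamics (pinnedChain ω₂ lam β γ), D.carrier ⊆ (pinnedChain ω₂ lam β γ).bmGood →
          D.PreservesMeasure μ →
          (∀ t : ℝ, ∀ᵐ σ ∂μ, D.flow t (shift σ) = shift (D.flow t σ)) →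
          (∀ t : ℝ, D.HasAbsConvergentCorrelation μ t) →
          (∀ M : ℝ, 0 < M → ∀ F : ℝ → ℝ, F = (fun u : ℝ => max (-M) (min M u)) → ∀ η : ℝ, 0 < η →
            ∃ τ₀ : ℝ, ∀ τ : ℝ, τ₀ ≤ τ → ∃ L₀ : ℕ, ∀ L : ℕ, L₀ ≤ L →
              ∀ G : ChainConfig → ℝ,
                G = (fun σ : ChainConfig => ∑ x ∈ Finset.Icc (-(L : ℤ)) (L : ℤ), F ((pinnedChain ω₂ lam β γ).bondCurrentZ σ x)) →
                |(τ⁻¹ * ∫ t in (0:ℝ)..τ, ((∫ σ, F ((pinnedChain ω₂ lam β γ).bondCurrentZ (D.flow t σ) 0) * G σ ∂μ) -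
                  (∫ σ, F ((pinnedChain ω₂ lam β γ).bondCurrentZ (D.flow t σ) 0) ∂μ) * (∫ σ, G σ ∂μ)))| ≤ η) →
          Tendsto (fun τ : ℝ => τ⁻¹ * ∫ t in (0:ℝ)..τ, D.currentCorrelation μ t) atTop (𝓝 0)

/-- The open core in the UNIVERSAL form of route `CurrentTiltQuench` (all `μ`-preserving dynamics): VERBATIM the consequent of
`CurrentTiltQuench.DrudeFromTruncation` (stmt-11032) under its hypotheses minus the `NoTruncatedDrude` body. Kept as a named statement (it was the
registered stub Z of R2–R3; the glue file `Theorems/JunctionLocalityNonBallisticOfZeroDrudeWeight.lean` consumes it); it implies Z′ trivially. -/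
def stub_zeroDrudeWeightInfiniteChain : Prop :=
    ∀ ω₂ lam β γ : ℝ, 0 < ω₂ → 0 < lam → 0 < β → ∀ T : ℝ, 0 < T →
      ∀ μ : Measure ChainConfig, (pinnedChain ω₂ lam β γ).IsChainGibbsMeasure T μ → IsShiftInvariant μ →
        μ.map (fun σ : ChainConfig => fun x : ℤ => ((σ x).1, -(σ x).2)) = μ →
        ∀ D : InfiniteChainDynamics (pinnedChain ω₂ lam β γ), D.PreservesMeasure μ →
          (∀ t : ℝ, ∀ᵐ σ ∂μ, D.flow t (shift σ) = shift (D.flow t σ)) →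
          (∀ t : ℝ, D.HasAbsConvergentCorrelation μ t) →
          Tendsto (fun τ : ℝ => τ⁻¹ * ∫ t in (0:ℝ)..τ, D.currentCorrelation μ t) atTop (𝓝 0)

/-- Statement of `stub_windowLimitOfPointwise` (A1). -/
def stub_windowLimitOfPointwise : Prop :=
    ∀ (f : ℕ → ℝ → ℝ) (g : ℝ → ℝ) (B : ℝ), (∀ N : ℕ, Continuous (f N)) → Measurable g →
      (∀ N : ℕ, ∀ s : ℝ, 0 ≤ s → |f N s| ≤ B * (N : ℝ)) →
      (∀ s : ℝ, 0 ≤ s → Tendsto (fun N : ℕ => f N s / (N : ℝ)) atTop (𝓝 (g s))) →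
      ∀ t : ℝ, 0 < t →
        Tendsto (fun N : ℕ => (2 * ∫ s in (0 : ℝ)..t, (t - s) * f N s) / (N : ℝ)) atTop
          (𝓝 (2 * ∫ s in (0 : ℝ)..t, (t - s) * g s))

/-- Statement of `stub_cesaroTwoOfCesaroOne` (A2). -/
def stub_cesaroTwoOfCesaroOne : Prop :=
    ∀ (g : ℝ → ℝ) (B : ℝ), Measurable g → (∀ s : ℝ, 0 ≤ s → |g s| ≤ B) →
      Tendsto (fun τ : ℝ => τ⁻¹ * ∫ t in (0:ℝ)..τ, g t) atTop (𝓝 0) →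
      ∀ ε : ℝ, 0 < ε → ∃ t : ℝ, 0 < t ∧ (2 * ∫ s in (0 : ℝ)..t, (t - s) * g s) ≤ ε * t ^ 2

/-- Statement of `stub_bulkWindowDynamicalMatching` (F1a). -/
def stub_bulkWindowDynamicalMatching : Prop :=
    ∀ ω₂ lam β γ : ℝ, 0 < ω₂ → 0 < lam → 0 < β → 0 < γ → ∀ T : ℝ, 0 < T →
          ∀ (hB1 : (pinnedChain ω₂ lam β γ).CondB1)
            (ι : (N : ℕ) → ℕ → PhaseSpace N → ChainConfig),
            (∀ (N a : ℕ) (z : PhaseSpace N) (i : ℤ),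
              ι N a z i = if h : 0 ≤ i + (a : ℤ) ∧ i + (a : ℤ) < N then
                (z.1 ⟨(i + (a : ℤ)).toNat, by omega⟩, z.2 ⟨(i + (a : ℤ)).toNat, by omega⟩)
                else (0, 0)) →
          ∀ (t : ℝ), 0 ≤ t → ∀ (x : ℤ) (ε : ℝ), 0 < ε → ∃ R₀ : ℕ, ∀ R : ℕ, R₀ ≤ R →
            ∀ N a : ℕ, R + 1 ≤ a → a + R + 3 ≤ N →
            (((pinnedChain ω₂ lam β γ).gibbsMeasure N T).prod wienerPair)
              {q : PhaseSpace N × WienerPair |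
                ε < |(pinnedChain ω₂ lam β γ).bondCurrentZ
                      (ι N a ((pinnedChain ω₂ lam β γ).solMap N T T t q.1 (pairPath q.2))) x -
                    (pinnedChain ω₂ lam β γ).bondCurrentZ
                      (OscillatorChain.severedFlow hB1 (Finset.Icc (-(R : ℤ)) R) t (ι N a q.1)) x|} ≤ ENNReal.ofReal ε

/-- Statement of `stub_bulkAnchorMatchingOfDynamicalMatching` (F1′). -/
def stub_bulkAnchorMatchingOfDynamicalMatching : Prop :=
    (∀ ω₂ lam β γ : ℝ, 0 < ω₂ → 0 < lam → 0 < β → 0 < γ → ∀ T : ℝ, 0 < T →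
          ∀ (hB1 : (pinnedChain ω₂ lam β γ).CondB1)
            (ι : (N : ℕ) → ℕ → PhaseSpace N → ChainConfig),
            (∀ (N a : ℕ) (z : PhaseSpace N) (i : ℤ),
              ι N a z i = if h : 0 ≤ i + (a : ℤ) ∧ i + (a : ℤ) < N then
                (z.1 ⟨(i + (a : ℤ)).toNat, by omega⟩, z.2 ⟨(i + (a : ℤ)).toNat, by omega⟩)
                else (0, 0)) →
          ∀ (t : ℝ), 0 ≤ t → ∀ (x : ℤ) (ε : ℝ), 0 < ε → ∃ R₀ : ℕ, ∀ R : ℕ, R₀ ≤ R →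
            ∀ N a : ℕ, R + 1 ≤ a → a + R + 3 ≤ N →
            (((pinnedChain ω₂ lam β γ).gibbsMeasure N T).prod wienerPair)
              {q : PhaseSpace N × WienerPair |
                ε < |(pinnedChain ω₂ lam β γ).bondCurrentZ
                      (ι N a ((pinnedChain ω₂ lam β γ).solMap N T T t q.1 (pairPath q.2))) x -
                    (pinnedChain ω₂ lam β γ).bondCurrentZ
                      (OscillatorChain.severedFlow hB1 (Finset.Icc (-(R : ℤ)) R) t (ι N a q.1)) x|} ≤ ENNReal.ofReal ε) →
    ∀ ω₂ lam β γ : ℝ, 0 < ω₂ → 0 < lam → 0 < β → 0 < γ → ∀ T : ℝ, 0 < T →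
          ∀ (μ : Measure ChainConfig) (D : InfiniteChainDynamics (pinnedChain ω₂ lam β γ)),
            (pinnedChain ω₂ lam β γ).IsChainGibbsMeasure T μ → IsShiftInvariant μ →
            D.carrier ⊆ (pinnedChain ω₂ lam β γ).bmGood → D.PreservesMeasure μ →
            (∀ t : ℝ, D.HasAbsConvergentCorrelation μ t) →
            ∀ (x : ℤ) (t : ℝ), 0 ≤ t → ∀ ε : ℝ, 0 < ε → ∃ L N₀ : ℕ, ∀ N : ℕ, N₀ ≤ N →
              ∀ a : ℕ, L ≤ a → a + L < N →
              |(if h : 0 ≤ (a : ℤ) + x ∧ (a : ℤ) + x < N ∧ a < N then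
                  ∫ z, (pinnedChain ω₂ lam β γ).bondCurrent N ⟨a, h.2.2⟩ z *
                    (∫ y, (pinnedChain ω₂ lam β γ).bondCurrent N ⟨((a : ℤ) + x).toNat, by omega⟩ y
                      ∂((pinnedChain ω₂ lam β γ).transitionKernel N T T t.toNNReal z))
                    ∂((pinnedChain ω₂ lam β γ).gibbsMeasure N T)
                else 0) -
                ∫ σ, (pinnedChain ω₂ lam β γ).bondCurrentZ σ 0 * (pinnedChain ω₂ lam β γ).bondCurrentZ (D.flow t σ) x ∂μ| ≤ ε

/-- Statement of `stub_fixedTimeThermodynamicLimitOfBulkMatching` (F2). -/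
def stub_fixedTimeThermodynamicLimitOfBulkMatching : Prop :=
    (∀ ω₂ lam β γ : ℝ, 0 < ω₂ → 0 < lam → 0 < β → 0 < γ → ∀ T : ℝ, 0 < T →
          ∀ (μ : Measure ChainConfig) (D : InfiniteChainDynamics (pinnedChain ω₂ lam β γ)),
            (pinnedChain ω₂ lam β γ).IsChainGibbsMeasure T μ → IsShiftInvariant μ →
            D.carrier ⊆ (pinnedChain ω₂ lam β γ).bmGood → D.PreservesMeasure μ →
            (∀ t : ℝ, D.HasAbsConvergentCorrelation μ t) →
            ∀ (x : ℤ) (t : ℝ), 0 ≤ t → ∀ ε : ℝ, 0 < ε → ∃ L N₀ : ℕ, ∀ N : ℕ, N₀ ≤ N →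
              ∀ a : ℕ, L ≤ a → a + L < N →
              |(if h : 0 ≤ (a : ℤ) + x ∧ (a : ℤ) + x < N ∧ a < N then
                  ∫ z, (pinnedChain ω₂ lam β γ).bondCurrent N ⟨a, h.2.2⟩ z *
                    (∫ y, (pinnedChain ω₂ lam β γ).bondCurrent N ⟨((a : ℤ) + x).toNat, by omega⟩ y
                      ∂((pinnedChain ω₂ lam β γ).transitionKernel N T T t.toNNReal z))
                    ∂((pinnedChain ω₂ lam β γ).gibbsMeasure N T)
                else 0) -
                ∫ σ, (pinnedChain ω₂ lam β γ).bondCurrentZ σ 0 * (pinnedChain ω₂ lam β γ).bondCurrentZ (D.flow t σ) x ∂μ| ≤ ε) →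
    ∀ ω₂ lam β γ : ℝ, 0 < ω₂ → 0 < lam → 0 < β → 0 < γ → ∀ T : ℝ, 0 < T →
        ∀ C : ℕ → ℝ → ℝ,
          C = (fun (N : ℕ) (s : ℝ) => ∫ x, (∑ i : Fin N, (pinnedChain ω₂ lam β γ).bondCurrent N i x) *
                (∫ y, (∑ i : Fin N, (pinnedChain ω₂ lam β γ).bondCurrent N i y)
                  ∂((pinnedChain ω₂ lam β γ).transitionKernel N T T s.toNNReal x))
                ∂((pinnedChain ω₂ lam β γ).gibbsMeasure N T)) →
          ∀ (μ : Measure ChainConfig) (D : InfiniteChainDynamics (pinnedChain ω₂ lam β γ)),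
            (pinnedChain ω₂ lam β γ).IsChainGibbsMeasure T μ → IsShiftInvariant μ →
            D.carrier ⊆ (pinnedChain ω₂ lam β γ).bmGood → D.PreservesMeasure μ →
            (∀ t : ℝ, D.HasAbsConvergentCorrelation μ t) →
            ∀ s : ℝ, 0 ≤ s →
              Tendsto (fun N : ℕ => C N s / (N : ℝ)) atTop (𝓝 (D.currentCorrelation μ s))

end Registered


/-! ## The strategist's two children of W (texts VERBATIM `SplitRouteContextProbe.lean` / `Theorems/JunctionLocalityNonBallisticSplit.lean`) -/

/-- `FixedTimeCurrentLocality` — thermodynamic limit AT FIXED TIME of the per-site window variance: `∃ v, ∀ t > 0, V_N(t)/N → v(t)`. -/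
def FixedTimeCurrentLocality : Prop :=
    ∀ ω₂ lam β γ : ℝ, 0 < ω₂ → 0 < lam → 0 < β → 0 < γ → ∀ T : ℝ, 0 < T →
    ∀ C : ℕ → ℝ → ℝ,
      C = (fun (N : ℕ) (s : ℝ) => ∫ x, (∑ i : Fin N, (pinnedChain ω₂ lam β γ).bondCurrent N i x) *
            (∫ y, (∑ i : Fin N, (pinnedChain ω₂ lam β γ).bondCurrent N i y)
              ∂((pinnedChain ω₂ lam β γ).transitionKernel N T T s.toNNReal x))
            ∂((pinnedChain ω₂ lam β γ).gibbsMeasure N T)) →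
      ∃ v : ℝ → ℝ, ∀ t : ℝ, 0 < t →
        Tendsto (fun N : ℕ => (2 * ∫ s in (0 : ℝ)..t, (t - s) * C N s) / (N : ℝ)) atTop (𝓝 (v t))

/-- `ZeroDrudeWeightLiminf` — `∀ ε > 0 ∃ t > 0, v(t) ≤ ε t²` for every fixed-time limit `v` of `V_N(t)/N`. -/
def ZeroDrudeWeightLiminf : Prop :=
    ∀ ω₂ lam β γ : ℝ, 0 < ω₂ → 0 < lam → 0 < β → 0 < γ → ∀ T : ℝ, 0 < T →
    ∀ C : ℕ → ℝ → ℝ,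
      C = (fun (N : ℕ) (s : ℝ) => ∫ x, (∑ i : Fin N, (pinnedChain ω₂ lam β γ).bondCurrent N i x) *
            (∫ y, (∑ i : Fin N, (pinnedChain ω₂ lam β γ).bondCurrent N i y)
              ∂((pinnedChain ω₂ lam β γ).transitionKernel N T T s.toNNReal x))
            ∂((pinnedChain ω₂ lam β γ).gibbsMeasure N T)) →
      ∀ v : ℝ → ℝ,
        (∀ t : ℝ, 0 < t →
          Tendsto (fun N : ℕ => (2 * ∫ s in (0 : ℝ)..t, (t - s) * C N s) / (N : ℝ)) atTop (𝓝 (v t))) →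
        ∀ ε : ℝ, 0 < ε → ∃ t : ℝ, 0 < t ∧ v t ≤ ε * t ^ 2

/-! ## The composition: the stubs and (K) give the crux BY NAME (no `sorry` below) -/

/-- The universal open core implies its regular-witness form (trivial). -/
theorem zeroDrudeWeightRegular_of_infiniteChain (hZ : Registered.stub_zeroDrudeWeightInfiniteChain) :
    Registered.stub_zeroDrudeWeightRegular :=
  fun ω₂ lam β γ hω hl hβ T hT μ hG hS hR D _hcar hP hcomm hAC =>
    hZ ω₂ lam β γ hω hl hβ T hT μ hG hS hR D hP hcomm hAC

/-- **Z is a filed item of route `CurrentTiltQuench`** (universal form): `DrudeFromTruncation` (stmt-AtomisticToContinuum-11032) and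
`NoTruncatedDrude` (stmt-AtomisticToContinuum-11030) give `stub_zeroDrudeWeightInfiniteChain` by modus ponens at each admissible pair. -/
theorem zeroDrudeWeightInfiniteChain_of_currentTiltQuench
    (h32 : Summit.AtomisticToContinuum.FouriersLaw.Theses.CurrentTiltQuench.DrudeFromTruncation)
    (h30 : Summit.AtomisticToContinuum.FouriersLaw.Theses.CurrentTiltQuench.NoTruncatedDrude) :
    Registered.stub_zeroDrudeWeightInfiniteChain := by
  intro ω₂ lam β γ hω hl hβ T hT μ hG hS hR D hP hcomm hAC
  exact h32 ω₂ lam β γ hω hl hβ T hT μ hG hS hR D hP hcomm hAC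
    (fun M hM F hF => h30 ω₂ lam β γ hω hl hβ T hT μ hG hS hR D hP hcomm M hM F hF)

/-- 11032 verbatim implies its regular-witness restriction DFT′ (trivial). -/
theorem drudeFromTruncationRegular_of_currentTiltQuench
    (h32 : Summit.AtomisticToContinuum.FouriersLaw.Theses.CurrentTiltQuench.DrudeFromTruncation) :
    Registered.stub_drudeFromTruncationRegular :=
  fun ω₂ lam β γ hω hl hβ T hT μ hG hS hR D _hcar hP hcomm hAC hNTD =>
    h32 ω₂ lam β γ hω hl hβ T hT μ hG hS hR D hP hcomm hAC hNTD

/-- **Z′ = DFT′ ∧ 11030**: the provable half and the route item `CurrentTiltQuench.NoTruncatedDrude` (stmt-11030, quantified over all dynamics,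
hence over regular ones) give the open core in regular-witness form. -/
theorem zeroDrudeWeightRegular_of_drudeFromTruncationRegular (hDFT : Registered.stub_drudeFromTruncationRegular)
    (h30 : Summit.AtomisticToContinuum.FouriersLaw.Theses.CurrentTiltQuench.NoTruncatedDrude) :
    Registered.stub_zeroDrudeWeightRegular := by
  intro ω₂ lam β γ hω hl hβ T hT μ hG hS hR D hcar hP hcomm hAC
  exact hDFT ω₂ lam β γ hω hl hβ T hT μ hG hS hR D hcar hP hcomm hAC
    (fun M hM F hF => h30 ω₂ lam β γ hω hl hβ T hT μ hG hS hR D hP hcomm M hM F hF)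

/-- Measurability of the limit: the Green–Kubo integrand restricted to `s ≥ 0` is the pointwise limit of the measurable functions
`𝟙_{s ≥ 0} C_N(s)/N`. -/
theorem measurable_indicator_of_limit {C : ℕ → ℝ → ℝ} {c : ℝ → ℝ} (hcont : ∀ N : ℕ, Continuous (C N))
    (hlim : ∀ s : ℝ, 0 ≤ s → Tendsto (fun N : ℕ => C N s / (N : ℝ)) atTop (𝓝 (c s))) :
    Measurable (Set.indicator (Set.Ici (0 : ℝ)) c) := by
  refine measurable_of_tendsto_metrizable
    (f := fun N : ℕ => Set.indicator (Set.Ici (0 : ℝ)) (fun s => C N s / (N : ℝ))) ?_ ?_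
  · intro N
    exact ((hcont N).measurable.div_const _).indicator measurableSet_Ici
  · rw [tendsto_pi_nhds]
    intro s
    by_cases hs : 0 ≤ s
    · have hs' : s ∈ Set.Ici (0 : ℝ) := Set.mem_Ici.2 hs
      simp only [Set.indicator_of_mem hs']
      exact hlim s hs
    · have hs' : s ∉ Set.Ici (0 : ℝ) := fun h => hs (Set.mem_Ici.1 h)
      simp only [Set.indicator_of_notMem hs']
      exact tendsto_const_nhds

/-- **DOM ∧ WIT ∧ FTL∞ ∧ A1 ⇒ `FixedTimeCurrentLocality`**, with `v(t) = 2∫₀ᵗ (t-s) C_∞(s) ds` along an admissible pair. -/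
theorem fixedTimeCurrentLocality_of
    (hDOM : Registered.stub_autocorrelationDomination) (hWIT : Registered.stub_infiniteVolumeWitness)
    (hFTL : Registered.stub_fixedTimeThermodynamicLimit) (hA1 : Registered.stub_windowLimitOfPointwise) :
    FixedTimeCurrentLocality := by
  intro ω₂ lam β γ hω hl hβ hγ T hT C hC
  obtain ⟨μ, D, hG, hS, -, hcar, hP, -, hAC⟩ := hWIT ω₂ lam β γ hω hl hβ hγ T hT
  obtain ⟨B, hB⟩ := hDOM ω₂ lam β γ hω hl hβ hγ T hT C hC
  have hlim := hFTL ω₂ lam β γ hω hl hβ hγ T hT C hC μ D hG hS hcar hP hAC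
  have hcont : ∀ N : ℕ, Continuous (C N) :=
    Summit.AtomisticToContinuum.FouriersLaw.Theorems.NonBallistic.stub_autocorrelationContinuous
      ω₂ lam β γ hω hl hβ hγ T hT C hC
  set g : ℝ → ℝ := Set.indicator (Set.Ici (0 : ℝ)) (D.currentCorrelation μ) with hg
  have hgm : Measurable g := measurable_indicator_of_limit hcont hlim
  have hlim' : ∀ s : ℝ, 0 ≤ s → Tendsto (fun N : ℕ => C N s / (N : ℝ)) atTop (𝓝 (g s)) := fun s hs => by
    rw [hg, Set.indicator_of_mem (Set.mem_Ici.2 hs)]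
    exact hlim s hs
  exact ⟨fun t => 2 * ∫ s in (0 : ℝ)..t, (t - s) * g s, fun t ht => hA1 C g B hcont hgm hB hlim' t ht⟩

/-- **DOM ∧ WIT ∧ FTL∞ ∧ Z′ ∧ A1 ∧ A2 ⇒ `ZeroDrudeWeightLiminf`**: any fixed-time limit `v` agrees (uniqueness of limits) with
`2∫₀ᵗ (t-s) C_∞(s) ds`, whose Cesàro hypothesis is Z′ at the REGULAR admissible pair of WIT. -/
theorem zeroDrudeWeightLiminf_of
    (hDOM : Registered.stub_autocorrelationDomination) (hWIT : Registered.stub_infiniteVolumeWitness)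
    (hFTL : Registered.stub_fixedTimeThermodynamicLimit) (hZ : Registered.stub_zeroDrudeWeightRegular)
    (hA1 : Registered.stub_windowLimitOfPointwise) (hA2 : Registered.stub_cesaroTwoOfCesaroOne) :
    ZeroDrudeWeightLiminf := by
  intro ω₂ lam β γ hω hl hβ hγ T hT C hC v hv ε hε
  obtain ⟨μ, D, hG, hS, hR, hcar, hP, hcomm, hAC⟩ := hWIT ω₂ lam β γ hω hl hβ hγ T hT
  obtain ⟨B, hB⟩ := hDOM ω₂ lam β γ hω hl hβ hγ T hT C hC
  have hlim := hFTL ω₂ lam β γ hω hl hβ hγ T hT C hC μ D hG hS hcar hP hAC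
  have hcont : ∀ N : ℕ, Continuous (C N) :=
    Summit.AtomisticToContinuum.FouriersLaw.Theorems.NonBallistic.stub_autocorrelationContinuous
      ω₂ lam β γ hω hl hβ hγ T hT C hC
  set g : ℝ → ℝ := Set.indicator (Set.Ici (0 : ℝ)) (D.currentCorrelation μ) with hg
  have hgm : Measurable g := measurable_indicator_of_limit hcont hlim
  have hg_of : ∀ s : ℝ, 0 ≤ s → g s = D.currentCorrelation μ s := fun s hs => by
    rw [hg, Set.indicator_of_mem (Set.mem_Ici.2 hs)]
  have hlim' : ∀ s : ℝ, 0 ≤ s → Tendsto (fun N : ℕ => C N s / (N : ℝ)) atTop (𝓝 (g s)) := fun s hs => by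
    rw [hg_of s hs]
    exact hlim s hs
  -- the `N`-uniform bound passes to the limit
  have hgB : ∀ s : ℝ, 0 ≤ s → |g s| ≤ B := fun s hs => by
    have h1 : Tendsto (fun N : ℕ => |C N s / (N : ℝ)|) atTop (𝓝 (|g s|)) :=
      (continuous_abs.tendsto _).comp (hlim' s hs)
    refine le_of_tendsto h1 ?_
    filter_upwards [eventually_ge_atTop 1] with N hN
    have hNpos : (0 : ℝ) < (N : ℝ) := by exact_mod_cast hN
    rw [abs_div, abs_of_pos hNpos, div_le_iff₀ hNpos]
    exact hB N s hs
  -- zero Drude weight at the (regular) admissible pair, transported to `g`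
  have hces0 := hZ ω₂ lam β γ hω hl hβ T hT μ hG hS hR D hcar hP hcomm hAC
  have hces : Tendsto (fun τ : ℝ => τ⁻¹ * ∫ t in (0:ℝ)..τ, g t) atTop (𝓝 0) := by
    refine hces0.congr' ?_
    filter_upwards [eventually_ge_atTop (0 : ℝ)] with τ hτ
    congr 1
    refine intervalIntegral.integral_congr fun t ht => ?_
    rw [Set.uIcc_of_le hτ] at ht
    exact (hg_of t ht.1).symm
  -- a good time for `g`, and uniqueness of the fixed-time limit
  obtain ⟨t, ht, hvt⟩ := hA2 g B hgm hgB hces ε hε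
  have hmine : Tendsto (fun N : ℕ => (2 * ∫ s in (0 : ℝ)..t, (t - s) * C N s) / (N : ℝ)) atTop
      (𝓝 (2 * ∫ s in (0 : ℝ)..t, (t - s) * g s)) := hA1 C g B hcont hgm hB hlim' t ht
  have heq : v t = 2 * ∫ s in (0 : ℝ)..t, (t - s) * g s := tendsto_nhds_unique (hv t ht) hmine
  exact ⟨t, ht, heq ▸ hvt⟩

/-- **The thermodynamic-limit stubs and Z′ imply R1's open stub**: DOM ∧ WIT ∧ FTL∞ ∧ Z′ ∧ A1 ∧ A2 ⇒ `SubballisticTransitWindow`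
(through the landed p123204). -/
theorem subballisticTransitWindow_of
    (hDOM : Registered.stub_autocorrelationDomination) (hWIT : Registered.stub_infiniteVolumeWitness)
    (hFTL : Registered.stub_fixedTimeThermodynamicLimit) (hZ : Registered.stub_zeroDrudeWeightRegular)
    (hA1 : Registered.stub_windowLimitOfPointwise) (hA2 : Registered.stub_cesaroTwoOfCesaroOne) :
    SubballisticTransitWindow :=
  subballisticTransitWindow_of_fixedTimeLocality_of_zeroDrudeWeight
    (fixedTimeCurrentLocality_of hDOM hWIT hFTL hA1) (zeroDrudeWeightLiminf_of hDOM hWIT hFTL hZ hA1 hA2)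

/-- **`NonBallistic_of`** — kernel-checked composition of the line (reshape R3c, FINAL: NO STUB HYPOTHESIS LEFT): the route items (K)
`BondHeatUncertainty.ExtensiveSnapshotIrreversibility` (stmt-9121) and `CurrentTiltQuench.NoTruncatedDrude` (stmt-11030), both by name, give the
crux; EVERY stub of the line is a theorem of the tree and is discharged inside the proof (1–6 inside p123886; DOM p142901, WIT p143465, A1
p143858, A2 p144471; F1a p146462, F1′ p148329, F2 p149719; DFT′ p155805). Tree form: `Theorems/JunctionLocalityNonBallisticOfNoTruncatedDrude.lean`
(`nonBallistic_of_extensiveSnapshotIrreversibility_of_noTruncatedDrude`, p156168). -/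
theorem NonBallistic_of
    (hK : Summit.AtomisticToContinuum.FouriersLaw.Theses.BondHeatUncertainty.ExtensiveSnapshotIrreversibility)
    (h30 : Summit.AtomisticToContinuum.FouriersLaw.Theses.CurrentTiltQuench.NoTruncatedDrude) :
    Summit.AtomisticToContinuum.FouriersLaw.Theses.JunctionLocality.NonBallistic :=
  nonBallistic_of_subballisticTransitWindow hK
    (subballisticTransitWindow_of stub_autocorrelationDomination stub_infiniteVolumeWitness stub_fixedTimeThermodynamicLimit
      (zeroDrudeWeightRegular_of_drudeFromTruncationRegular stub_drudeFromTruncationRegular h30) stub_windowLimitOfPointwise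
      stub_cesaroTwoOfCesaroOne)

/-- **`NonBallistic_of_zeroDrudeWeight`** — the same composition with the open core Z′ (`stub_zeroDrudeWeightRegular`) as the hypothesis. -/
theorem NonBallistic_of_zeroDrudeWeight
    (hK : Summit.AtomisticToContinuum.FouriersLaw.Theses.BondHeatUncertainty.ExtensiveSnapshotIrreversibility)
    (hZ : Registered.stub_zeroDrudeWeightRegular) :
    Summit.AtomisticToContinuum.FouriersLaw.Theses.JunctionLocality.NonBallistic :=
  nonBallistic_of_subballisticTransitWindow hK
    (subballisticTransitWindow_of stub_autocorrelationDomination stub_infiniteVolumeWitness stub_fixedTimeThermodynamicLimit hZ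
      stub_windowLimitOfPointwise stub_cesaroTwoOfCesaroOne)

/-- **`FixedTimeCurrentLocality` HOLDS** (the strategist's child 2a of the crux, "L–XL, provable technology"): unconditional after wave 2. -/
theorem fixedTimeCurrentLocality_holds : FixedTimeCurrentLocality :=
  fixedTimeCurrentLocality_of stub_autocorrelationDomination stub_infiniteVolumeWitness stub_fixedTimeThermodynamicLimit
    stub_windowLimitOfPointwise

/-- **`ZeroDrudeWeightLiminf` ⟸ Z′** (the strategist's child 2b follows from zero Drude weight of the infinite chain along regular witnesses). -/
theorem zeroDrudeWeightLiminf_of_zeroDrudeWeightRegular (hZ : Registered.stub_zeroDrudeWeightRegular) :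
    ZeroDrudeWeightLiminf :=
  zeroDrudeWeightLiminf_of stub_autocorrelationDomination stub_infiniteVolumeWitness stub_fixedTimeThermodynamicLimit hZ
    stub_windowLimitOfPointwise stub_cesaroTwoOfCesaroOne

/-! ## Wiring: the actual stubs feed the composition; the sibling copies of the decl close by `Iff.rfl`; the CurrentTiltQuench supply line -/

/-- Wiring check: the actual stubs and the route items (K) (stmt-9121) and `NoTruncatedDrude` (stmt-11030), by name, give the crux. -/
example (hK : Summit.AtomisticToContinuum.FouriersLaw.Theses.BondHeatUncertainty.ExtensiveSnapshotIrreversibility)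
    (h30 : Summit.AtomisticToContinuum.FouriersLaw.Theses.CurrentTiltQuench.NoTruncatedDrude) :
    Summit.AtomisticToContinuum.FouriersLaw.Theses.JunctionLocality.NonBallistic :=
  NonBallistic_of hK h30

/-- Wiring check (open-core form): (K) and the actual stub Z′ give the crux. -/
example (hK : Summit.AtomisticToContinuum.FouriersLaw.Theses.BondHeatUncertainty.ExtensiveSnapshotIrreversibility) :
    Summit.AtomisticToContinuum.FouriersLaw.Theses.JunctionLocality.NonBallistic :=
  NonBallistic_of_zeroDrudeWeight hK stub_zeroDrudeWeightRegular

/-- The `BondHeatUncertainty` and `PuiseuxTransferLedger` copies of the decl are the same statement (`Iff.rfl`, Disproof §8). -/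
example (hK : Summit.AtomisticToContinuum.FouriersLaw.Theses.BondHeatUncertainty.ExtensiveSnapshotIrreversibility) :
    Summit.AtomisticToContinuum.FouriersLaw.Theses.BondHeatUncertainty.NonBallistic :=
  NonBallistic_of_zeroDrudeWeight hK stub_zeroDrudeWeightRegular

/-- **Supply line.** With the open core supplied by route `CurrentTiltQuench` (items 11032 ∧ 11030, universal forms) the crux needs only (K)
(stmt-9121): `NonBallistic ⟸ 9121 ∧ 11030 ∧ 11032`, kernel-checked. -/
example (hK : Summit.AtomisticToContinuum.FouriersLaw.Theses.BondHeatUncertainty.ExtensiveSnapshotIrreversibility)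
    (h32 : Summit.AtomisticToContinuum.FouriersLaw.Theses.CurrentTiltQuench.DrudeFromTruncation)
    (h30 : Summit.AtomisticToContinuum.FouriersLaw.Theses.CurrentTiltQuench.NoTruncatedDrude) :
    Summit.AtomisticToContinuum.FouriersLaw.Theses.JunctionLocality.NonBallistic :=
  NonBallistic_of_zeroDrudeWeight hK
    (zeroDrudeWeightRegular_of_infiniteChain (zeroDrudeWeightInfiniteChain_of_currentTiltQuench h32 h30))

end Summit.AtomisticToContinuum.FouriersLaw.Cruxes.NonBallistic.DrudeControlsConductance

end
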